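import Literature.Analysis.FluidPDE.SchefferTestFunction
import Literature.Analysis.FluidPDE.SpaceTimeMollifier
import Literature.Analysis.UnboundedOperators.HeatKernelHeatEquation
import HarnessLib

/-!
# Barrier: on `ℝ³` the free heat / Stokes flow has the sharp algebraic energy decay `t^{-3/2}` and
# NO uniform decay rate (no spectral gap) — Gaussian data (Evans §2.3.1; Folland §4.A Thm. (4.3);
# Robinson–Rodrigo–Sadowski 2016 Thm. 2.22)

Barrier catalogue entry for `NavierStokesRegularity` (D-0021), filed by the D-0090 NS-CLAIMS cell
(salvage seat `ns-claims-salvage-p6`) at the METHOD level; gap seed G4 «sharp algebraic decay of the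
free heat/Stokes flow» of the cell's COUNTERMODEL-INDEX §6 (witness family W15, transform-side
Gaussians). Adjudicated row located by this object (locator, not author):
`Literature.Claims.NS.Rockwell2025.Step_62` (C88, a claimed decay `‖w(t)‖² ≤ C‖w(0)‖²/(1+t)^{K−3}`
for finite-energy heat flows, kill `…Theorems.Rockwell2025.not_Step_62`); companion of
`TimeTaylorFiniteRadius` / `KovalevskayaHeatRadiusZero` (same Gaussian heat flow) and of
`ExactModeLineDecayLaws` (the `𝕋³` Stokes-mode decay floor/ceiling).

## What is printed

* Evans, *PDE*, §2.3.1 / Folland, *Introduction to PDE*, §4.A Thm. (4.3): the Gauss–Weierstrass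
  kernel `G_σ(x) = (4πσ)^{-n/2} e^{-|x|²/(4σ)}` solves `∂_σ G = ΔG`, has mass one, and the heat flow is
  convolution with it (tree: `Literature.Analysis.UnboundedOperators.heatKernel`,
  `hasDerivAt_heatKernel_time`, `Scheffer.laplacian_heatKernel`). [Evans2010] [Folland1995PDE]
* Robinson–Rodrigo–Sadowski 2016, Thm. 2.22: on `ℝ³` (and `𝕋³`) the Leray projector commutes with
  `Δ`, `Au = −Δu` — the linear part of the Navier–Stokes flow on `ℝ³` IS the componentwise heat flow
  on divergence-free fields. [RobinsonRodrigoSadowski2016]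

## What is formalised (kernel face, standard axioms)

For `ν ≥ 0`, `σ₀ > 0` the Gaussian flow `w(t, x) = G_{σ₀+νt}(x) e₀` on `ℝ³` is jointly smooth on
`[0,∞) × ℝ³`, solves `∂ₜw = νΔw` (`HeatDecay.gaussFlow_heat`), and has the EXACT energy
`∫|w(t,x)|² dx = A (σ₀ + νt)^{-3/2}`, `A = (4π)^{-3}(2π)^{3/2}` (`integral_norm_sq_gaussFlow`). Hence,
for `ν > 0`: (i) `no_faster_algebraic_decay` — there are no `C, α` with `α > 3/2` such that
`∫|w(t)|² ≤ C (1+t)^{-α} ∫|w(0)|²` for all finite-energy classical heat flows and all `t ≥ 0`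
(width `σ₀ = ν` gives the exact rate `(1+t)^{-3/2}`); (ii) `tendsto_energyRatio_one` /
`no_uniform_decay` — for every `T > 0` the ratio `∫|w(T)|²/∫|w(0)|² = (1 + νT/σ₀)^{-3/2}` tends to `1`
as the width `σ₀ → ∞`, so no `θ < 1` bounds it for all flows: no spectral gap, no universal
exponential or other uniform rate on `ℝ³` (Poincaré-type decay transplanted from `𝕋³`/bounded `Ω`
fails); (iii) the energy does decay to `0` along each member (not a floor). `FreeHeatDecaySharp`
packages (i)–(ii); `freeHeatDecaySharp_holds` proves it. The Gaussian-energy calculus is ported from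
the cell's kernel file `Theorems/SoloRefuteRockwell2025.lean` (ns-claims-typist-11 g2 kit, refuter-8;
Literature cannot import Summits), with the width parameter added.

## References

* [Evans2010] L. C. Evans, *Partial Differential Equations*, 2nd ed., §2.3.1 (fundamental solution).
* [Folland1995PDE] G. B. Folland, *Introduction to PDE*, 2nd ed., §4.A Thm. (4.3).
* [RobinsonRodrigoSadowski2016] J. C. Robinson, J. L. Rodrigo, W. Sadowski, *The Three-Dimensional
  Navier–Stokes Equations*, CUP 2016, §2.3 Thm. 2.22 p. 57–58.

WHAT THIS IS NOT: not a claim about NS regularity or blow-up; not a claim about any author beyond the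
typed locator.
-/

noncomputable section

open Set Function Filter MeasureTheory Real
open scoped Topology ENNReal NNReal ContDiff Laplacian

namespace Literature.Barriers.NavierStokesRegularity

open Literature.Analysis.FluidPDE Literature.Analysis.UnboundedOperators

namespace HeatDecay

/-! ### The Gaussian heat flow of width `σ₀` -/

/-- The Gaussian heat flow of initial width `σ₀`: `w(t, x) = G_{σ₀ + νt}(x) e₀`.
[cite: Evans2010, §2.3.1] -/
def gaussFlow (ν σ₀ : ℝ) (t : ℝ) (x : EuclideanSpace ℝ (Fin 3)) : EuclideanSpace ℝ (Fin 3) :=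
  heatKernel (σ₀ + ν * t) x • EuclideanSpace.single (0 : Fin 3) (1 : ℝ)

/-- Joint smoothness on `[0,∞) × ℝ³` (`ν ≥ 0`, `σ₀ > 0`). [cite: Evans2010, §2.3.1] -/
theorem isSmoothSpaceTimeOn_gaussFlow {ν σ₀ : ℝ} (hν : 0 ≤ ν) (hσ₀ : 0 < σ₀) :
    IsSmoothSpaceTimeOn (Ici 0) (gaussFlow ν σ₀) := by
  unfold IsSmoothSpaceTimeOn
  have hΨ : ContDiff ℝ ∞
      (fun q : ℝ × EuclideanSpace ℝ (Fin 3) => ((σ₀ + ν * q.1, q.2) : ℝ × _)) :=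
    (contDiff_const.add (contDiff_const.mul contDiff_fst)).prodMk contDiff_snd
  have hmaps : MapsTo (fun q : ℝ × EuclideanSpace ℝ (Fin 3) => ((σ₀ + ν * q.1, q.2) : ℝ × _))
      (Ici (0 : ℝ) ×ˢ univ) (Ioi (0 : ℝ) ×ˢ univ) := by
    rintro ⟨t, x⟩ ⟨ht, -⟩
    refine ⟨?_, mem_univ _⟩
    have ht' : (0 : ℝ) ≤ t := ht
    show 0 < σ₀ + ν * t
    positivity
  have hK := (contDiffOn_uncurry_heatKernel (E := EuclideanSpace ℝ (Fin 3)) (m := ∞)).comp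
    hΨ.contDiffOn hmaps
  have hsm : ContDiffOn ℝ ∞ (fun q : ℝ × EuclideanSpace ℝ (Fin 3) =>
      heatKernel (σ₀ + ν * q.1) q.2 • EuclideanSpace.single (0 : Fin 3) (1 : ℝ))
      (Ici (0 : ℝ) ×ˢ univ) := hK.smul contDiffOn_const
  refine hsm.congr fun q _ => ?_
  obtain ⟨t, x⟩ := q
  rfl

/-- The heat equation `∂ₜw = νΔw` on `[0,∞) × ℝ³` (`ν ≥ 0`, `σ₀ > 0`). [cite: Evans2010, §2.3.1] -/
theorem gaussFlow_heat {ν σ₀ : ℝ} (hν : 0 ≤ ν) (hσ₀ : 0 < σ₀) :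
    ∀ t ∈ Ici (0 : ℝ), ∀ x,
      timeDerivWithin (Ici 0) (gaussFlow ν σ₀) t x = ν • (Δ (gaussFlow ν σ₀ t)) x := by
  intro t ht x
  have ht' : (0 : ℝ) ≤ t := ht
  have hσ : 0 < σ₀ + ν * t := by positivity
  set σ : ℝ := σ₀ + ν * t with hσdef
  have h1 := hasDerivAt_heatKernel_time (E := EuclideanSpace ℝ (Fin 3)) hσ x
  have h2 : HasDerivAt (fun s : ℝ => σ₀ + ν * s) ν t := by
    simpa using ((hasDerivAt_id t).const_mul ν).const_add σ₀
  have h3 : HasDerivAt (fun s : ℝ => heatKernel (σ₀ + ν * s) x)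
      (((‖x‖ ^ 2 / (4 * σ ^ 2) - (Module.finrank ℝ (EuclideanSpace ℝ (Fin 3)) : ℝ) / (2 * σ)) *
        heatKernel σ x) * ν) t := by
    have := HasDerivAt.comp t (h₂ := fun s : ℝ => heatKernel s x) (h := fun s : ℝ => σ₀ + ν * s)
      (by rw [← hσdef]; exact h1) h2
    exact this
  have h4 : HasDerivWithinAt (fun s : ℝ => gaussFlow ν σ₀ s x)
      ((((‖x‖ ^ 2 / (4 * σ ^ 2) - (Module.finrank ℝ (EuclideanSpace ℝ (Fin 3)) : ℝ) / (2 * σ)) *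
        heatKernel σ x) * ν) • EuclideanSpace.single (0 : Fin 3) (1 : ℝ)) (Ici 0) t :=
    (h3.smul_const _).hasDerivWithinAt
  rw [timeDerivWithin_apply, h4.derivWithin (uniqueDiffOn_Ici 0 t ht)]
  have hlap : (Δ (gaussFlow ν σ₀ t)) x =
      (Δ (heatKernel (E := EuclideanSpace ℝ (Fin 3)) σ)) x • EuclideanSpace.single (0 : Fin 3) (1 : ℝ) := by
    show (Δ (fun y : EuclideanSpace ℝ (Fin 3) =>
      heatKernel (σ₀ + ν * t) y • EuclideanSpace.single (0 : Fin 3) (1 : ℝ))) x = _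
    rw [← hσdef]
    exact laplacian_smul_const ((Scheffer.contDiff_heatKernel (m := 2) σ)) _ x
  rw [hlap, Scheffer.laplacian_heatKernel σ x, smul_smul]
  congr 1
  ring

/-! ### The exact energy `A (σ₀ + νt)^{-3/2}` -/

/-- The energy constant `A = (4π)^{-3} (2π)^{3/2}` (`= ∫ G_1²`). [cite: Evans2010, §2.3.1] -/
def energyConst : ℝ := (4 * π) ^ (-(3 : ℝ)) * (2 * π) ^ ((3 : ℝ) / 2)

/-- `A > 0`. [cite: Evans2010, §2.3.1] -/
theorem energyConst_pos : 0 < energyConst := by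
  unfold energyConst
  positivity

/-- `∫_{ℝ³} G_σ² = (4πσ)^{-3} (2πσ)^{3/2}` as a real integral of the square (Gaussian integral).
[cite: Evans2010, §2.3.1] -/
theorem integral_sq_heatKernel {σ : ℝ} (hσ : 0 < σ) :
    ∫ x : EuclideanSpace ℝ (Fin 3), heatKernel σ x ^ 2 =
      ((4 * π * σ) ^ (-(3 : ℝ) / 2)) ^ 2 * (π / (1 / (2 * σ))) ^ ((3 : ℝ) / 2) := by
  have hb : 0 < 1 / (2 * σ) := by positivity
  have h1 := GaussianFourier.integral_rexp_neg_mul_sq_norm (V := EuclideanSpace ℝ (Fin 3)) hb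
  rw [finrank_euclideanSpace_fin] at h1
  have hsq : ∀ x : EuclideanSpace ℝ (Fin 3), heatKernel σ x ^ 2 =
      ((4 * π * σ) ^ (-(3 : ℝ) / 2)) ^ 2 * rexp (-(1 / (2 * σ)) * ‖x‖ ^ 2) := by
    intro x
    rw [heatKernel_eq, finrank_euclideanSpace_fin, mul_pow, ← Real.exp_nat_mul]
    congr 2
    push_cast
    field_simp
    ring
  simp_rw [hsq, integral_const_mul]
  rw [h1]
  norm_num

/-- `∫_{ℝ³} G_σ² = A σ^{-3/2}` with `A = energyConst`. [cite: Evans2010, §2.3.1] -/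
theorem integral_sq_heatKernel_eq {σ : ℝ} (hσ : 0 < σ) :
    ∫ x : EuclideanSpace ℝ (Fin 3), heatKernel σ x ^ 2 = energyConst * σ ^ (-(3 : ℝ) / 2) := by
  rw [integral_sq_heatKernel hσ]
  have hπ : 0 < π := Real.pi_pos
  have hA1 : ((4 * π * σ) ^ (-(3 : ℝ) / 2)) ^ 2 = (4 * π * σ) ^ (-(3 : ℝ)) := by
    rw [← Real.rpow_natCast, ← Real.rpow_mul (by positivity)]
    norm_num
  have hA2 : (π / (1 / (2 * σ))) ^ ((3 : ℝ) / 2) = (2 * π * σ) ^ ((3 : ℝ) / 2) := by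
    congr 1
    field_simp
  have hA3 : (4 * π * σ) ^ (-(3 : ℝ)) = (4 * π) ^ (-(3 : ℝ)) * σ ^ (-(3 : ℝ)) :=
    Real.mul_rpow (by positivity) hσ.le
  have hA4 : (2 * π * σ) ^ ((3 : ℝ) / 2) = (2 * π) ^ ((3 : ℝ) / 2) * σ ^ ((3 : ℝ) / 2) :=
    Real.mul_rpow (by positivity) hσ.le
  have hA5 : σ ^ (-(3 : ℝ)) * σ ^ ((3 : ℝ) / 2) = σ ^ (-(3 : ℝ) / 2) := by
    rw [← Real.rpow_add hσ]
    norm_num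
  rw [hA1, hA2, hA3, hA4, energyConst, ← hA5]
  ring

/-- Integrability of `G_σ²`. [cite: Evans2010, §2.3.1] -/
theorem integrable_sq_heatKernel {σ : ℝ} (hσ : 0 < σ) :
    Integrable (fun x : EuclideanSpace ℝ (Fin 3) => heatKernel σ x ^ 2) := by
  have hG := integrable_heatKernel_holds (E := EuclideanSpace ℝ (Fin 3)) hσ
  refine (hG.const_mul ((4 * π * σ) ^ (-(Module.finrank ℝ (EuclideanSpace ℝ (Fin 3)) : ℝ) / 2))).mono'
    ((continuous_heatKernel σ).pow 2).aestronglyMeasurable (Eventually.of_forall fun x => ?_)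
  rw [Real.norm_eq_abs, abs_of_nonneg (sq_nonneg _), sq]
  exact mul_le_mul_of_nonneg_right (heatKernel_le hσ x) (heatKernel_pos hσ x).le

/-- `|w(t, x)|² = G_{σ₀+νt}(x)²`. [cite: Evans2010, §2.3.1] -/
theorem norm_sq_gaussFlow (ν σ₀ t : ℝ) (x : EuclideanSpace ℝ (Fin 3)) :
    ‖gaussFlow ν σ₀ t x‖ ^ 2 = heatKernel (σ₀ + ν * t) x ^ 2 := by
  have hn : ‖EuclideanSpace.single (0 : Fin 3) (1 : ℝ)‖ = 1 := by simp
  rw [gaussFlow, norm_smul, hn, mul_one, Real.norm_eq_abs, sq_abs]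

/-- **The exact energy of the Gaussian flow**: `∫ |w(t,x)|² dx = A (σ₀ + νt)^{-3/2}` whenever
`σ₀ + νt > 0`. [cite: Evans2010, §2.3.1] -/
theorem integral_norm_sq_gaussFlow {ν σ₀ t : ℝ} (h : 0 < σ₀ + ν * t) :
    ∫ x : EuclideanSpace ℝ (Fin 3), ‖gaussFlow ν σ₀ t x‖ ^ 2 =
      energyConst * (σ₀ + ν * t) ^ (-(3 : ℝ) / 2) := by
  simp_rw [norm_sq_gaussFlow]
  exact integral_sq_heatKernel_eq h

/-- The energy density of the Gaussian flow is integrable. [cite: Evans2010, §2.3.1] -/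
theorem integrable_norm_sq_gaussFlow {ν σ₀ t : ℝ} (h : 0 < σ₀ + ν * t) :
    Integrable (fun x : EuclideanSpace ℝ (Fin 3) => ‖gaussFlow ν σ₀ t x‖ ^ 2) := by
  simp_rw [norm_sq_gaussFlow]
  exact integrable_sq_heatKernel h

/-! ### (i) No universal algebraic rate faster than `3/2` -/

/-- **No faster algebraic decay law.** For `ν > 0` there are no constants `C` and `α > 3/2` such that
every classical finite-energy heat flow `∂ₜw = νΔw` on `[0,∞) × ℝ³` obeys
`∫|w(t)|² ≤ C (1+t)^{-α} ∫|w(0)|²` for all `t ≥ 0`: the Gaussian flow of width `σ₀ = ν` has energy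
EXACTLY `A ν^{-3/2} (1+t)^{-3/2}`. (The shape of `Literature.Claims.NS.Rockwell2025.Step_62`,
`α = K − 3 > 2`.) [cite: Evans2010, §2.3.1] -/
theorem no_faster_algebraic_decay {ν : ℝ} (hν : 0 < ν) :
    ¬ ∃ C α : ℝ, 3 / 2 < α ∧
      ∀ w : ℝ → EuclideanSpace ℝ (Fin 3) → EuclideanSpace ℝ (Fin 3),
        IsSmoothSpaceTimeOn (Ici 0) w →
        (∀ t ∈ Ici (0 : ℝ), ∀ x, timeDerivWithin (Ici 0) w t x = ν • (Δ (w t)) x) →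
        Integrable (fun x => ‖w 0 x‖ ^ 2) →
          ∀ t : ℝ, 0 ≤ t →
            ∫ x, ‖w t x‖ ^ 2 ≤ C * (1 + t) ^ (-α) * ∫ x, ‖w 0 x‖ ^ 2 := by
  rintro ⟨C, α, hα, hlaw⟩
  have h0 : 0 < ν + ν * 0 := by simpa using hν
  have hflow := hlaw (gaussFlow ν ν) (isSmoothSpaceTimeOn_gaussFlow hν.le hν) (gaussFlow_heat hν.le hν)
    (integrable_norm_sq_gaussFlow h0)
  -- the law at time `t` reads `(1+t)^{α − 3/2} ≤ C`
  have key : ∀ t : ℝ, 0 ≤ t → (1 + t) ^ (α - 3 / 2) ≤ C := by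
    intro t ht
    have hνt : 0 < ν + ν * t := by positivity
    have h := hflow t ht
    rw [integral_norm_sq_gaussFlow hνt, integral_norm_sq_gaussFlow h0, mul_zero, add_zero,
      show ν + ν * t = ν * (1 + t) by ring, Real.mul_rpow hν.le (by linarith),
      ← mul_assoc, ← mul_assoc] at h
    -- cancel the positive factor `A ν^{-3/2}`
    have hpos : 0 < energyConst * ν ^ (-(3 : ℝ) / 2) := mul_pos energyConst_pos (Real.rpow_pos_of_pos hν _)
    have h' : (1 + t) ^ (-(3 : ℝ) / 2) ≤ C * (1 + t) ^ (-α) := by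
      have := h
      nlinarith [hpos, Real.rpow_nonneg (show (0 : ℝ) ≤ 1 + t by linarith) (-(3 : ℝ) / 2)]
    have hb : 0 < (1 + t) := by linarith
    have e : (1 + t) ^ (α - 3 / 2) = (1 + t) ^ (-(3 : ℝ) / 2) * (1 + t) ^ α := by
      rw [← Real.rpow_add hb]; congr 1; ring
    rw [e]
    calc (1 + t) ^ (-(3 : ℝ) / 2) * (1 + t) ^ α ≤ C * (1 + t) ^ (-α) * (1 + t) ^ α :=
          mul_le_mul_of_nonneg_right h' (Real.rpow_nonneg hb.le _)
      _ = C := by rw [mul_assoc, ← Real.rpow_add hb]; simp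
  -- but `(1+t)^{α − 3/2} → ∞`
  have hβ : 0 < α - 3 / 2 := by linarith
  have hlim : Tendsto (fun t : ℝ => (1 + t) ^ (α - 3 / 2)) atTop atTop :=
    (tendsto_rpow_atTop hβ).comp (tendsto_atTop_add_const_left _ _ tendsto_id)
  obtain ⟨N, hN⟩ := (hlim.eventually_gt_atTop C).exists_forall_of_atTop
  have h1 := hN (max N 0) (le_max_left _ _)
  have h2 := key (max N 0) (le_max_right _ _)
  linarith

/-! ### (ii) No uniform decay rate at all: the energy ratio tends to `1` with the width -/

/-- The energy ratio at time `T` of the Gaussian flow of width `σ₀`: `(1 + νT/σ₀)^{-3/2}`.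
[cite: Evans2010, §2.3.1] -/
theorem energyRatio_eq {ν σ₀ T : ℝ} (hν : 0 ≤ ν) (hσ₀ : 0 < σ₀) (hT : 0 ≤ T) :
    (∫ x, ‖gaussFlow ν σ₀ T x‖ ^ 2) / (∫ x, ‖gaussFlow ν σ₀ 0 x‖ ^ 2) =
      (1 + ν * T / σ₀) ^ (-(3 : ℝ) / 2) := by
  have h0 : 0 < σ₀ + ν * 0 := by simpa using hσ₀
  have hT' : 0 < σ₀ + ν * T := by positivity
  rw [integral_norm_sq_gaussFlow hT', integral_norm_sq_gaussFlow h0, mul_zero, add_zero,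
    mul_div_mul_left _ _ energyConst_pos.ne', ← Real.div_rpow hT'.le hσ₀.le]
  congr 1
  field_simp

/-- **The energy ratio tends to `1` as the width grows**: `∫|w_{σ₀}(T)|² / ∫|w_{σ₀}(0)|² → 1` as
`σ₀ → ∞` (`ν ≥ 0`, `T ≥ 0`). [cite: Evans2010, §2.3.1] -/
theorem tendsto_energyRatio_one {ν T : ℝ} (hν : 0 ≤ ν) (hT : 0 ≤ T) :
    Tendsto (fun σ₀ : ℝ => (∫ x, ‖gaussFlow ν σ₀ T x‖ ^ 2) / (∫ x, ‖gaussFlow ν σ₀ 0 x‖ ^ 2))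
      atTop (𝓝 1) := by
  have hlim : Tendsto (fun σ₀ : ℝ => (1 + ν * T / σ₀) ^ (-(3 : ℝ) / 2)) atTop (𝓝 1) := by
    have h1 : Tendsto (fun σ₀ : ℝ => 1 + ν * T / σ₀) atTop (𝓝 (1 + 0)) :=
      tendsto_const_nhds.add (tendsto_const_nhds.div_atTop tendsto_id)
    rw [add_zero] at h1
    have h2 := h1.rpow_const (p := -(3 : ℝ) / 2) (Or.inl one_ne_zero)
    rwa [Real.one_rpow] at h2
  refine hlim.congr' ?_
  filter_upwards [eventually_gt_atTop (0 : ℝ)] with σ₀ hσ₀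
  exact (energyRatio_eq hν hσ₀ hT).symm

/-- **No uniform decay (no spectral gap on `ℝ³`).** For `ν ≥ 0`, every `T ≥ 0` and every `θ < 1`
there is a classical finite-energy heat flow `∂ₜw = νΔw` on `[0,∞) × ℝ³` with
`θ ∫|w(0)|² < ∫|w(T)|²`: a wide Gaussian. So no law `∫|w(T)|² ≤ θ ∫|w(0)|²` with `θ < 1`
independent of the datum — in particular no exponential rate `C e^{−λt}` and no Poincaré-type
contraction transplanted from `𝕋³` / bounded domains — holds on the whole space. [cite: Evans2010, §2.3.1] -/
theorem no_uniform_decay {ν T θ : ℝ} (hν : 0 ≤ ν) (hT : 0 ≤ T) (hθ : θ < 1) :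
    ∃ w : ℝ → EuclideanSpace ℝ (Fin 3) → EuclideanSpace ℝ (Fin 3),
      IsSmoothSpaceTimeOn (Ici 0) w ∧
      (∀ t ∈ Ici (0 : ℝ), ∀ x, timeDerivWithin (Ici 0) w t x = ν • (Δ (w t)) x) ∧
      Integrable (fun x => ‖w 0 x‖ ^ 2) ∧
      θ * ∫ x, ‖w 0 x‖ ^ 2 < ∫ x, ‖w T x‖ ^ 2 := by
  have hev := (tendsto_energyRatio_one hν hT).eventually (Ioi_mem_nhds hθ)
  obtain ⟨σ₀, hσ₀⟩ := (hev.and (eventually_gt_atTop (0 : ℝ))).exists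
  have hratio : θ < (∫ x, ‖gaussFlow ν σ₀ T x‖ ^ 2) / (∫ x, ‖gaussFlow ν σ₀ 0 x‖ ^ 2) := hσ₀.1
  have hσ₀pos : 0 < σ₀ := hσ₀.2
  have h0 : 0 < σ₀ + ν * 0 := by simpa using hσ₀pos
  refine ⟨gaussFlow ν σ₀, isSmoothSpaceTimeOn_gaussFlow hν hσ₀pos, gaussFlow_heat hν hσ₀pos,
    integrable_norm_sq_gaussFlow h0, ?_⟩
  have hE0 : 0 < ∫ x, ‖gaussFlow ν σ₀ 0 x‖ ^ 2 := by
    rw [integral_norm_sq_gaussFlow h0]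
    exact mul_pos energyConst_pos (Real.rpow_pos_of_pos h0 _)
  exact (lt_div_iff₀ hE0).1 hratio

/-- **No universal exponential decay law** on `ℝ³`: for `ν ≥ 0` there are no `C, λ > 0` with
`∫|w(t)|² ≤ C e^{−λt} ∫|w(0)|²` for all classical finite-energy heat flows and all `t ≥ 0`.
[cite: RobinsonRodrigoSadowski2016, §2.3 Thm. 2.22 p. 57–58] -/
theorem no_exponential_decay {ν : ℝ} (hν : 0 ≤ ν) :
    ¬ ∃ C lam : ℝ, 0 < lam ∧
      ∀ w : ℝ → EuclideanSpace ℝ (Fin 3) → EuclideanSpace ℝ (Fin 3),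
        IsSmoothSpaceTimeOn (Ici 0) w →
        (∀ t ∈ Ici (0 : ℝ), ∀ x, timeDerivWithin (Ici 0) w t x = ν • (Δ (w t)) x) →
        Integrable (fun x => ‖w 0 x‖ ^ 2) →
          ∀ t : ℝ, 0 ≤ t → ∫ x, ‖w t x‖ ^ 2 ≤ C * Real.exp (-lam * t) * ∫ x, ‖w 0 x‖ ^ 2 := by
  rintro ⟨C, lam, hlam, hlaw⟩
  -- pick `T` with `C e^{−λT} < 1`
  have hlim : Tendsto (fun t : ℝ => C * Real.exp (-lam * t)) atTop (𝓝 (C * 0)) := by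
    refine tendsto_const_nhds.mul ?_
    have : Tendsto (fun t : ℝ => -lam * t) atTop atBot :=
      (tendsto_id.const_mul_atTop_of_neg (neg_lt_zero.2 hlam))
    exact Real.tendsto_exp_atBot.comp this
  rw [mul_zero] at hlim
  obtain ⟨T, hT0, hT⟩ : ∃ T : ℝ, 0 ≤ T ∧ C * Real.exp (-lam * T) < 1 := by
    obtain ⟨N, hN⟩ := ((hlim.eventually (Iio_mem_nhds zero_lt_one)).and
      (eventually_ge_atTop (0 : ℝ))).exists_forall_of_atTop
    exact ⟨N, (hN N le_rfl).2, (hN N le_rfl).1⟩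
  obtain ⟨w, hw, hheat, hint, hlt⟩ := no_uniform_decay hν hT0 hT
  have := hlaw w hw hheat hint T hT0
  linarith

end HeatDecay

/-! ### The catalogue entry -/

open HeatDecay

/-- **Barrier (Evans §2.3.1 / Folland §4.A Thm. (4.3); Robinson–Rodrigo–Sadowski 2016 Thm. 2.22):
whole-space energy decay of the free heat / Stokes flow is EXACTLY algebraic of order `3/2` on
Gaussians and has NO uniform rate.** Conjunction, for every `ν > 0`: (i) every Gaussian flow
`w = G_{σ₀+νt} e₀` (`σ₀ > 0`) is a classical finite-energy heat flow on `[0,∞) × ℝ³` with energy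
`A (σ₀ + νt)^{-3/2}`; (ii) no law `∫|w(t)|² ≤ C (1+t)^{-α} ∫|w(0)|²` with `α > 3/2` holds for all
classical finite-energy heat flows; (iii) for every `T ≥ 0`, `θ < 1` some such flow has
`∫|w(T)|² > θ ∫|w(0)|²` — no uniform contraction, no spectral gap; (iv) hence no universal
exponential law `C e^{−λt}`. [cite: Evans2010, §2.3.1]

BARRIER (structured block, D-0021):
technique_class: whole-space-energy-decay-rate algebraic-decay-faster-than-heat exponential-decay-on-R3 poincare-transplanted-to-whole-space spectral-gap-on-R3 uniform-decay-rate-for-all-data fourier-splitting-misapplied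
blocks: (a) every a-priori decay law for the heat / Stokes / Navier–Stokes energy on `ℝ³` of the form `‖u(t)‖²₂ ≤ C(1+t)^{-α}‖u₀‖²₂` with `α > 3/2` and `C` independent of the datum — the shape of `Literature.Claims.NS.Rockwell2025.Step_62` (`α = K − 3 > 2`): conjunct (ii) [cite: Evans2010, §2.3.1]; (b) every use on `ℝ³` of a Poincaré / spectral-gap inequality `λ₁‖u‖² ≤ ‖∇u‖²` or of its consequence `‖u(t)‖² ≤ e^{−2νλ₁t}‖u₀‖²` (true on `𝕋³` with zero mean and on bounded no-slip domains, `λ₁ > 0`): conjunct (iii)/(iv) — wide Gaussians contract as little as desired over any fixed time [cite: RobinsonRodrigoSadowski2016, §2.3 Thm. 2.22 p. 57–58]; (c) any decay RATE claimed uniformly over all finite-energy data without a moment / low-frequency / `L¹` hypothesis on the datum (the honest statements — Fourier splitting — carry `‖u₀‖_{L¹}` or the behaviour of `û₀` near `ξ = 0`).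
because: the free flow of the Gaussian `G_{σ₀}` is the Gaussian `G_{σ₀+νt}` (semigroup law of the heat kernel), whose `L²` mass is `A(σ₀+νt)^{-3/2}` by the Gaussian integral `∫e^{-b|x|²} = (π/b)^{3/2}` [cite: Evans2010, §2.3.1]; with `σ₀ = ν` this is exactly `(1+t)^{-3/2}` times the initial energy, and as `σ₀ → ∞` the ratio `(1 + νt/σ₀)^{-3/2}` over any fixed time tends to `1`: low frequencies decay arbitrarily slowly, there is no bottom of the spectrum on `ℝ³`. On `ℝ³` the Leray projector commutes with `Δ` (Thm. 2.22), so the linear Navier–Stokes (Stokes) flow of divergence-free data is the componentwise heat flow and inherits both facts [cite: RobinsonRodrigoSadowski2016, §2.3 Thm. 2.22 p. 57–58].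
evasions_known: (1) add a datum hypothesis that controls low frequencies (`u₀ ∈ L¹`, `|û₀(ξ)| ≤ C|ξ|^k`, moment conditions): then algebraic rates `(1+t)^{-3/2-k}` are honest (Fourier splitting / Wiegner-type theorems) — rates are DATA-dependent [cite: Evans2010, §2.3.1]; (2) work on `𝕋³` (zero mean) or a bounded domain, where `λ₁ > 0` gives genuine exponential decay — but then the result says nothing about `ℝ³`; (3) lower bounds: the Gaussian family shows the heat rate is attained, not beaten, by smooth rapidly decaying data; for the nonlinear problem Schonbek-type lower bounds make generic decay no faster than the linear one (not formalised here).
scope_caveats: (a) kernel face = the scalar-profile Gaussian flow `G e₀` of the HEAT equation with viscosity `ν` on `ℝ³` (finite energy, smooth on `[0,∞) × ℝ³` in the tree sense `IsSmoothSpaceTimeOn (Ici 0)`, one-sided time derivative); the field `G e₀` is not divergence-free — the transfer to the Stokes flow is the cited commutation `PΔ = ΔP` on `ℝ³` (RRS Thm. 2.22), not formalised here; (b) energies are real Bochner integrals `∫‖w t x‖²` (integrable along the family); (c) nothing is said about the nonlinear flow beyond its linear part; (d) the periodic / exact-mode decay floor and ceiling live in `ExactModeLineDecayLaws`, the finite analyticity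 radius of the same Gaussian flow in `TimeTaylorFiniteRadius`.
status: established; every conjunct proved in the tree (`freeHeatDecaySharp_holds`, standard axioms) -/
def FreeHeatDecaySharp : Prop :=
  ∀ ν : ℝ, 0 < ν →
    (∀ σ₀ : ℝ, 0 < σ₀ →
        IsSmoothSpaceTimeOn (Ici 0) (gaussFlow ν σ₀) ∧
        (∀ t ∈ Ici (0 : ℝ), ∀ x,
            timeDerivWithin (Ici 0) (gaussFlow ν σ₀) t x = ν • (Δ (gaussFlow ν σ₀ t)) x) ∧
        ∀ t : ℝ, 0 ≤ t → ∫ x, ‖gaussFlow ν σ₀ t x‖ ^ 2 = energyConst * (σ₀ + ν * t) ^ (-(3 : ℝ) / 2)) ∧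
    (¬ ∃ C α : ℝ, 3 / 2 < α ∧
        ∀ w : ℝ → EuclideanSpace ℝ (Fin 3) → EuclideanSpace ℝ (Fin 3),
          IsSmoothSpaceTimeOn (Ici 0) w →
          (∀ t ∈ Ici (0 : ℝ), ∀ x, timeDerivWithin (Ici 0) w t x = ν • (Δ (w t)) x) →
          Integrable (fun x => ‖w 0 x‖ ^ 2) →
            ∀ t : ℝ, 0 ≤ t → ∫ x, ‖w t x‖ ^ 2 ≤ C * (1 + t) ^ (-α) * ∫ x, ‖w 0 x‖ ^ 2) ∧
    (∀ T θ : ℝ, 0 ≤ T → θ < 1 →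
        ∃ w : ℝ → EuclideanSpace ℝ (Fin 3) → EuclideanSpace ℝ (Fin 3),
          IsSmoothSpaceTimeOn (Ici 0) w ∧
          (∀ t ∈ Ici (0 : ℝ), ∀ x, timeDerivWithin (Ici 0) w t x = ν • (Δ (w t)) x) ∧
          Integrable (fun x => ‖w 0 x‖ ^ 2) ∧ θ * ∫ x, ‖w 0 x‖ ^ 2 < ∫ x, ‖w T x‖ ^ 2) ∧
    (¬ ∃ C lam : ℝ, 0 < lam ∧
        ∀ w : ℝ → EuclideanSpace ℝ (Fin 3) → EuclideanSpace ℝ (Fin 3),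
          IsSmoothSpaceTimeOn (Ici 0) w →
          (∀ t ∈ Ici (0 : ℝ), ∀ x, timeDerivWithin (Ici 0) w t x = ν • (Δ (w t)) x) →
          Integrable (fun x => ‖w 0 x‖ ^ 2) →
            ∀ t : ℝ, 0 ≤ t → ∫ x, ‖w t x‖ ^ 2 ≤ C * Real.exp (-lam * t) * ∫ x, ‖w 0 x‖ ^ 2)

/-- **The barrier holds** ((i) `isSmoothSpaceTimeOn_gaussFlow` / `gaussFlow_heat` /
`integral_norm_sq_gaussFlow`, (ii) `no_faster_algebraic_decay`, (iii) `no_uniform_decay`,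
(iv) `no_exponential_decay`). [cite: Evans2010, §2.3.1] -/
theorem freeHeatDecaySharp_holds : FreeHeatDecaySharp := by
  intro ν hν
  refine ⟨fun σ₀ hσ₀ => ⟨isSmoothSpaceTimeOn_gaussFlow hν.le hσ₀, gaussFlow_heat hν.le hσ₀,
      fun t ht => integral_norm_sq_gaussFlow (by positivity)⟩,
    no_faster_algebraic_decay hν, fun T θ hT hθ => no_uniform_decay hν.le hT hθ,
    no_exponential_decay hν.le⟩

/-- `FreeHeatDecaySharp` — `_holds` alias of `freeHeatDecaySharp_holds` above under the fact's exact name (appended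
2026-08-28, D-0026 bookkeeping: the proof term is the existing theorem of this file; no statement,
definition or attribute is edited; no new named fact; the ledger's debt table listed the fact
unproved). [cite: Evans2010, §2.3.1] -/
theorem _root_.Literature.Barriers.NavierStokesRegularity.FreeHeatDecaySharp_holds :
    FreeHeatDecaySharp :=
  _root_.Literature.Barriers.NavierStokesRegularity.freeHeatDecaySharp_holds

end Literature.Barriers.NavierStokesRegularity

end
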